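import Mathlib

/-!
# T5PropGSkeleton — the logical skeleton of route-3's §G «Proposition G» as named Props
(route/T5-CHECK-G-p7.md §3, steps S5–S8)

Route-3's §G derives, for each of the four branch characters `λ_i` (i = 111, 100, 101, 110),
«L(1, λ_i ν) ≠ 0 for all but finitely many ν ∈ Ξ_𝔭» from three inputs: the 𝔭-line measure
`L^-_{Σ_i, λ_i^{-1}, 𝔭}` is non-zero ([P1] Hsieh + [P2] Burungale–Hida, steps S1–S4), a non-zero
measure on `Γ_𝔭 ≅ ℤ_p` vanishes at only finitely many finite-order characters ([P3]
Weierstrass, step S5), and a non-zero `p`-adic value forces a non-zero complex `L`-value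
through the interpolation formula ([P4], step S6, with the dictionary `ν ↦ ν⁻¹` of §G.2).
This file records that skeleton as named Props over ABSTRACT data — a family `Ξ`, the
complex values `L : Ξ → ℂ`, the `p`-adic values `m : Ξ → W`, the bijection `inv : Ξ ≃ Ξ` — and
proves the two assembly implications: (i) for one branch, (ii) for the product over any finite
family of branches, and (iii) the sign constancy as a separate named Prop. Nothing about
L-functions, measures or Hecke characters is asserted: the analytic inputs S1–S6 are the
HYPOTHESES `FinitelyManyZeros` and `InterpolationTransfer`, exactly as the prose states them.
-/

namespace Summit.Ventures.HodgeRepro2.T5PropGSkeleton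

/-- The data of §G for ONE branch character `λ`: the family `Ξ` (= `Ξ_𝔭`, the finite-order
characters of `Γ_𝔭`), the complex values `L ν := L(1, λν)`, the `p`-adic values
`m ν := ∫ ν dL^-_{Σ, λ^{-1}, 𝔭}` in a ring `W` (= `W(𝔽̄_p)`), and the bijection `inv : ν ↦ ν⁻¹`
of the family (§G.2, L-value row: `L(0, λ^{-1}ν) = L(1, λ ν^{-1})`). -/
structure BranchData (Ξ W : Type*) [Ring W] where
  /-- `ν ↦ L(1, λν)` -/
  L : Ξ → ℂ
  /-- `ν ↦ ∫ ν dL^-_{Σ, λ^{-1}, 𝔭}` -/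
  m : Ξ → W
  /-- `ν ↦ ν⁻¹` -/
  inv : Ξ ≃ Ξ

variable {Ξ W : Type*} [Ring W]

/-- S1–S5 ([P1] + [P2] + [P3]): the 𝔭-line measure is non-zero and, being a power series in
`W[[T]]` evaluated at `ν(γ₀) − 1`, vanishes at only finitely many `ν`. -/
def FinitelyManyZeros (d : BranchData Ξ W) : Prop := {ν | d.m ν = 0}.Finite

/-- S6 ([P4], the interpolation formula read in the direction «p-adic value ≠ 0 ⟹ complex
L-value ≠ 0», composed with the dictionary `L(0, λ^{-1}ν) = L(1, λν^{-1})`): `m ν ≠ 0` forces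
`L (ν⁻¹) ≠ 0`. -/
def InterpolationTransfer (d : BranchData Ξ W) : Prop := ∀ ν, d.m ν ≠ 0 → d.L (d.inv ν) ≠ 0

/-- Conclusion (i) of Proposition G for one branch: `L(1, λν) ≠ 0` for all but finitely many `ν`. -/
def CofiniteNonvanishing (d : BranchData Ξ W) : Prop := {ν | d.L ν = 0}.Finite

/-- The zero set of `L` is contained in the image under `inv` of the zero set of `m`. -/
theorem zeroSet_subset (d : BranchData Ξ W) (h6 : InterpolationTransfer d) :
    {ν | d.L ν = 0} ⊆ d.inv '' {ν | d.m ν = 0} := by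
  intro ν hν
  refine ⟨d.inv.symm ν, ?_, d.inv.apply_symm_apply ν⟩
  by_contra hm
  have := h6 (d.inv.symm ν) hm
  rw [d.inv.apply_symm_apply] at this
  exact this hν

/-- (i), assembled: S1–S5 and S6 give cofinite non-vanishing of the complex `L`-values. -/
theorem cofinite_of_finitelyManyZeros_of_transfer (d : BranchData Ξ W)
    (h5 : FinitelyManyZeros d) (h6 : InterpolationTransfer d) : CofiniteNonvanishing d :=
  (h5.image d.inv).subset (zeroSet_subset d h6)

/-- The exceptional set of (i) has at most as many elements as the zero set of `m`. -/
theorem ncard_zeroSet_le (d : BranchData Ξ W) (h5 : FinitelyManyZeros d)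
    (h6 : InterpolationTransfer d) :
    {ν | d.L ν = 0}.ncard ≤ {ν | d.m ν = 0}.ncard := by
  calc {ν | d.L ν = 0}.ncard ≤ (d.inv '' {ν | d.m ν = 0}).ncard :=
        Set.ncard_le_ncard (zeroSet_subset d h6) (h5.image d.inv)
    _ = {ν | d.m ν = 0}.ncard := Set.ncard_image_of_injective _ d.inv.injective

/-- Conclusion (ii) of Proposition G for a finite family of branches (the four `λ_i`): the
product of the `L`-values is non-zero outside the finite union of the exceptional sets. -/
theorem prod_cofinite {ι : Type*} (I : Finset ι) (d : ι → BranchData Ξ W)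
    (h : ∀ i ∈ I, CofiniteNonvanishing (d i)) :
    {ν | (∏ i ∈ I, (d i).L ν) = 0}.Finite := by
  refine (I.finite_toSet.biUnion fun i hi => h i hi).subset ?_
  intro ν hν
  have h0 : (∏ i ∈ I, (d i).L ν) = 0 := hν
  obtain ⟨i, hi, hzero⟩ := Finset.prod_eq_zero_iff.mp h0
  exact Set.mem_biUnion (x := i) hi hzero

/-- (ii) in the form used by N5: for every `ν` outside a finite set, every `L(1, λ_i ν)` is
non-zero simultaneously. -/
theorem exists_finite_forall_ne_zero {ι : Type*} (I : Finset ι) (d : ι → BranchData Ξ W)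
    (h : ∀ i ∈ I, CofiniteNonvanishing (d i)) :
    ∃ Z : Set Ξ, Z.Finite ∧ ∀ ν ∉ Z, ∀ i ∈ I, (d i).L ν ≠ 0 := by
  refine ⟨⋃ i ∈ I, {ν | (d i).L ν = 0}, I.finite_toSet.biUnion fun i hi => h i hi, ?_⟩
  intro ν hν i hi h0
  exact hν (Set.mem_biUnion (x := i) hi h0)

/-- (iii) of Proposition G, as a named Prop on a sign function `eps : Ξ → ℤ` (`ν ↦ ε(λν)`):
the global root number is constant along the family and equals the root number of `λ`
(= `eps` at the trivial character `one`), here `+1` by (R-sign). Step S8 supplies it. -/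
def SignConstant (eps : Ξ → ℤ) (one : Ξ) : Prop := ∀ ν, eps ν = eps one

/-- If the sign is constant along the family and `+1` at the trivial character, it is `+1`
everywhere: `Ξ⁺_{λ,𝔭} = Ξ_𝔭`. -/
theorem eps_eq_one_of_signConstant (eps : Ξ → ℤ) (one : Ξ) (hc : SignConstant eps one)
    (h1 : eps one = 1) : ∀ ν, eps ν = 1 := fun ν => (hc ν).trans h1

/-- Proposition G assembled for a finite family of branches: (i) for each branch, (ii) for the
product, (iii) the sign, from the hypotheses S1–S6 and S8 of each branch. -/
theorem propG {ι : Type*} (I : Finset ι) (d : ι → BranchData Ξ W)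
    (h5 : ∀ i ∈ I, FinitelyManyZeros (d i)) (h6 : ∀ i ∈ I, InterpolationTransfer (d i))
    (eps : ι → Ξ → ℤ) (one : Ξ) (h8 : ∀ i ∈ I, SignConstant (eps i) one)
    (hsign : ∀ i ∈ I, eps i one = 1) :
    (∀ i ∈ I, CofiniteNonvanishing (d i)) ∧
      {ν | (∏ i ∈ I, (d i).L ν) = 0}.Finite ∧ ∀ i ∈ I, ∀ ν, eps i ν = 1 := by
  have hi : ∀ i ∈ I, CofiniteNonvanishing (d i) := fun i hi =>
    cofinite_of_finitelyManyZeros_of_transfer (d i) (h5 i hi) (h6 i hi)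
  exact ⟨hi, prod_cofinite I d hi, fun i hi' => eps_eq_one_of_signConstant (eps i) one
    (h8 i hi') (hsign i hi')⟩

end Summit.Ventures.HodgeRepro2.T5PropGSkeleton
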